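import Summits.ResolutionOfSingularities.ResolutionOfSingularities.Theorems.HilbertSamuelEliminationSigmaMaxModificationsCorridor3WLadderLocalPointBlowup
import Literature.AlgebraicGeometry.CossartJannsenSaito2020.NearPointProjDirectrix
import Literature.AlgebraicGeometry.CossartJannsenSaito2020.BlowupTowerLocalizeTransfer
import Literature.AlgebraicGeometry.Resolution.PermissibleBlowupDirectrixRational
import Literature.AlgebraicGeometry.Resolution.CofinalityFromPrincipalization
import Literature.AlgebraicGeometry.Resolution.DirectrixSchemeLocal
import Mathlib.RingTheory.KrullDimension.Basic
import HarnessLib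

/-!
# [OURS · L1 W4.2] THE RATIONAL NEAR STEP: at a genuine step at a point with `e = 1`, the near point keeps `e ≤ 1` (CJS p. 103,
# Def. 6.34 (i), Thm. 3.14, Thm. 3.10 (4)) — the `e`-propagation input of the `e = 1` bridge `Moving.IsoE1BridgeM` (third door of
# the W-low-char row; crux chain w42, line `w_ladder` v6, LEAD PROVER res-L1-w42-lead-1 gen 3)

OURS (cell res-hironaka, slot W4.2); NOT statements of H. Hironaka's manuscript [Hironaka2017] nor of [CossartJannsenSaito2020]; AI
proving, weaker than expert review. `--supports stmt-ResolutionOfSingularities-19249`.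

WHAT IS PROVED (modulo the three PRINTED named facts `Thm314_point_locus`, `ProjDir_line` (p503241, res-type-053) and
`CossartJannsenSaito2020_thm_3_10_4` (p499783)). Let `π : W' ⟶ W` be a blow-up of a locally noetherian EXCELLENT `W` (`dim W ≤ N`) in a
radical centre `C = 𝓘(V(C))` whose stalk at `x` is the maximal ideal (`C_x = 𝔪_x`: locally at `x` the step is the blow-up of the
point — `Helpers.stalkIdeal_centre_eq_maximalIdeal_of_isIsolated` p503609 / `Moving.stalkIdeal_centre_eq_maximalIdeal_of_dirDim_le_one`
p503215), with `CharHypothesis W x` and `e_x(W) = 1`; let `x' ∈ W'` lie over `x` with `H^N(x') = H^N(x)` (near). Then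
**`e_{x'}(W') ≤ 1`** (`dirDim_le_one_of_near_of_dirDim_eq_one`). Route (all on the LOCAL blow-up `W' ×_W Spec 𝒪_{W,x} → Spec 𝒪_{W,x}`,
res-L1-w42-stub-2's p504248): it is the blow-up of the closed point (`isBlowup_pullback_snd_fromSpecStalk_singleton`), the centre `{𝔪}` is
permissible (`𝔪` is not a minimal prime since `1 = e ≤ dim 𝒪`), `Spec 𝒪_{W,x}` is excellent (Matsumura §32) and carries `CharHypothesis`
(`charHypothesis_spec_stalk`), `x'` lifts to a near point `y` with the same local ring (`exists_lift_pullback_fromSpecStalk`,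
`hsFun_lift_eq_hsFun_closedPoint`); `Thm314_point_locus` puts `y` on `ℙ(Dir_𝔪)`, `ProjDir_line` (`e = 1`) makes it RATIONAL
(`IsIso` of the residue field map), and `dirDim_le_of_hsFun_eq_of_isIso_residueFieldMap` (p508213, CJS Thm. 3.10 (4)) gives
`e(y) ≤ e(𝔪) = e_x(W) = 1`; finally `e(y) = e_{x'}(W')` (`dirDim_lift_eq`). Also recorded: the rational lift itself
(`exists_rational_lift_of_near_of_dirDim_eq_one`).

## References

* V. Cossart, U. Jannsen, S. Saito, LNM 2270 (2020), Thm. 3.14, Thm. 3.10 (4), Def. 6.34 (i), p. 103 L32, p. 107. [CossartJannsenSaito2020]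
* H. Matsumura, *Commutative Ring Theory* (1987), §32. [Matsumura1987]
-/

noncomputable section

set_option linter.dupNamespace false -- mandated namespace of this single-conjunct summit

open CategoryTheory CategoryTheory.Limits AlgebraicGeometry TopologicalSpace IsLocalRing
open Literature.AlgebraicGeometry.Resolution Literature.RingTheory.HilbertSamuel
open Literature.AlgebraicGeometry.CossartJannsenSaito2020
open Scheme.IdealSheafData

namespace Summit.ResolutionOfSingularities.ResolutionOfSingularities.Theorems.SigmaMaxModificationsCorridor3.Helpers

universe u

/-! ## The local scheme `Spec 𝒪_{W,x}`: (F1), and permissibility of the closed point -/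

/-- The residue characteristic does not change along a morphism: `char κ(s) = char κ(f s)`. [folklore] -/
theorem ringChar_residueField_eq_of_hom' {S X : Scheme.{u}} (f : S ⟶ X) (s : S) :
    ringChar (ResidueField (S.presheaf.stalk s)) = ringChar (ResidueField (X.presheaf.stalk (f.base s))) := by
  haveI : IsLocalHom (f.stalkMap s).hom := f.toLRSHom.prop s
  let φ := ResidueField.map (f.stalkMap s).hom
  haveI : CharP (ResidueField (X.presheaf.stalk (f.base s))) (ringChar (ResidueField (S.presheaf.stalk s))) :=
    (φ.charP_iff_charP _).mpr (ringChar.charP _)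
  exact (ringChar.eq _ _).symm

/-- A value of `WithBot ℕ∞` squeezed between `0` and a natural number is a natural number. [folklore] -/
theorem exists_nat_eq_of_nonneg_of_le {v : WithBot ℕ∞} {d : ℕ} (h0 : 0 ≤ v) (h : v ≤ (d : WithBot ℕ∞)) :
    ∃ d' : ℕ, v = (d' : WithBot ℕ∞) ∧ d' ≤ d := by
  induction v using WithBot.recBotCoe with
  | bot => exact absurd h0 (by simp)
  | coe w =>
    induction w using ENat.recTopCoe with
    | top => exact absurd (top_le_iff.mp (WithBot.coe_le_coe.mp h)) (ENat.coe_ne_top d)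
    | coe n =>
      refine ⟨n, rfl, ?_⟩
      have : ((n : ℕ∞) : WithBot ℕ∞) ≤ ((d : ℕ∞) : WithBot ℕ∞) := h
      exact_mod_cast this

/-- **(F1) transfers to the closed point of `Spec 𝒪_{W,x}`** (same residue characteristic, `dim Spec 𝒪_{W,x} ≤ dim W`; the
scheme-level form of res-type-053's `BlowupTower.charHypothesis_localize`). [cite: CossartJannsenSaito2020, Thm. 10.2, p. 107] -/
theorem charHypothesis_spec_stalk {W : Scheme.{u}} [IsLocallyNoetherian W] {x : W} (h : CharHypothesis W x) :
    CharHypothesis (Spec (W.presheaf.stalk x)) (closedPoint (W.presheaf.stalk x)) := by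
  obtain ⟨d, hd, hchar⟩ := h
  have hle : topologicalKrullDim ↥(Spec (W.presheaf.stalk x)) ≤ (d : WithBot ℕ∞) :=
    hd ▸ (W.fromSpecStalk x).isEmbedding.isInducing.topologicalKrullDim_le
  have h0 : 0 ≤ topologicalKrullDim ↥(Spec (W.presheaf.stalk x)) := by
    let p : ↥(Spec (W.presheaf.stalk x)) := closedPoint (W.presheaf.stalk x)
    haveI : Nonempty (IrreducibleCloseds ↥(Spec (W.presheaf.stalk x))) :=
      ⟨⟨closure {p}, isIrreducible_singleton.closure, isClosed_closure⟩⟩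
    exact Order.krullDim_nonneg
  obtain ⟨d', hd', hd'd⟩ := exists_nat_eq_of_nonneg_of_le h0 hle
  have hκ : ringChar (ResidueField ((Spec (W.presheaf.stalk x)).presheaf.stalk (closedPoint (W.presheaf.stalk x)))) =
      ringChar (ResidueField (W.presheaf.stalk x)) := by
    have h1 := ringChar_residueField_eq_of_hom' (W.fromSpecStalk x) (closedPoint (W.presheaf.stalk x))
    rw [Scheme.fromSpecStalk_closedPoint] at h1
    exact h1
  refine ⟨d', hd', ?_⟩
  rw [hκ]
  rcases hchar with h0' | h2
  · exact Or.inl h0'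
  · exact Or.inr (by omega)

/-- In a local ring of dimension `≥ 1` the maximal ideal is not a minimal prime. [folklore] -/
theorem maximalIdeal_not_mem_minimalPrimes_of_one_le_ringKrullDim {A : Type u} [CommRing A] [IsLocalRing A]
    (h : (1 : WithBot ℕ∞) ≤ ringKrullDim A) : maximalIdeal A ∉ minimalPrimes A := by
  intro hmin
  have hall : ∀ I : Ideal A, I.IsPrime → I.IsMaximal := by
    intro I hI
    have hle : maximalIdeal A ≤ I := hmin.2 ⟨hI, bot_le⟩ (IsLocalRing.le_maximalIdeal hI.ne_top)
    rw [le_antisymm (IsLocalRing.le_maximalIdeal hI.ne_top) hle]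
    exact IsLocalRing.maximalIdeal.isMaximal A
  haveI : Ring.KrullDimLE 0 A := Ring.krullDimLE_zero_iff.mpr hall
  have h0 : ringKrullDim A ≤ 0 := Ring.krullDimLE_iff.mp inferInstance
  have : (1 : WithBot ℕ∞) ≤ 0 := h.trans h0
  exact absurd this (by decide)

/-- **The closed point of `Spec 𝒪_{W,x}` is a permissible centre when `e_x(W) ≥ 1`** (`1 ≤ e_x ≤ dim 𝒪_{W,x}`, so `𝔪_x` is not a
minimal prime; tree `isPermissible_vanishingIdeal_singleton_iff`; the point is written `c` with `(W.fromSpecStalk x) c = x`, the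
convention of `Moving.isBlowup_pullback_snd_fromSpecStalk_singleton`). [cite: CossartJannsenSaito2020, Def. 3.1 (2), Def. 6.34 (i)] -/
theorem isPermissible_vanishingIdeal_singleton_of_fromSpecStalk_eq_of_one_le_dirDim {W : Scheme.{u}} [IsLocallyNoetherian W] {x : W}
    (he : 1 ≤ Scheme.dirDim W x) {c : ↥(Spec (W.presheaf.stalk x))} (hc : (W.fromSpecStalk x).base c = x) :
    IdealSheafData.IsPermissible (vanishingIdeal (⟨{c}, Moving.isClosed_singleton_of_fromSpecStalk_eq hc⟩ :
      Closeds ↥(Spec (W.presheaf.stalk x)))) := by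
  rw [isPermissible_vanishingIdeal_singleton_iff]
  obtain rfl := Moving.eq_closedPoint_of_fromSpecStalk_eq hc
  apply maximalIdeal_not_mem_minimalPrimes_of_one_le_ringKrullDim
  have h1 : (1 : WithBot ℕ∞) ≤
      (Scheme.dirDim (Spec (W.presheaf.stalk x)) (closedPoint (W.presheaf.stalk x)) : WithBot ℕ∞) := by
    rw [Scheme.dirDim_fromSpecStalk_closedPoint]
    exact_mod_cast he
  exact h1.trans (Scheme.natCast_dirDim_le_ringKrullDim_stalk _)

/-! ## The rational near step -/

section Step

variable {W W' : Scheme.{u}}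

/-- Notation-free abbreviation used only in docstrings: `P := W' ×_W Spec 𝒪_{W,x}`, `p₁ = pullback.fst`, `p₂ = pullback.snd`. The
setting at the point `c := p₂ y` over `x` of `Spec 𝒪_{W,x}`: excellent, `dim ≤ N`, (F1), `e(c) = 1`, `{c}` permissible, and the local
blow-up `p₂` is the blow-up of `{c}`. [cite: CossartJannsenSaito2020, p. 107, Def. 6.34 (i)] -/
theorem localSetting_of_lift [IsLocallyNoetherian W] (hexc : Scheme.IsExcellent W) {N : ℕ} (hdim : topologicalKrullDim W ≤ (N : WithBot ℕ∞))
    {π : W' ⟶ W} {C : W.IdealSheafData} (hπ : IsBlowup π C) (hC : C = vanishingIdeal C.support) {x : W}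
    (hx : stalkIdeal C x = maximalIdeal (W.presheaf.stalk x)) (hchar : CharHypothesis W x) (he : Scheme.dirDim W x = 1)
    {y : ↥(pullback π (W.fromSpecStalk x))}
    (hyc : (W.fromSpecStalk x).base ((pullback.snd π (W.fromSpecStalk x)).base y) = x) :
    Scheme.IsExcellent (Spec (W.presheaf.stalk x)) ∧
      topologicalKrullDim ↥(Spec (W.presheaf.stalk x)) ≤ (N : WithBot ℕ∞) ∧
      CharHypothesis (Spec (W.presheaf.stalk x)) ((pullback.snd π (W.fromSpecStalk x)).base y) ∧
      Scheme.dirDim (Spec (W.presheaf.stalk x)) ((pullback.snd π (W.fromSpecStalk x)).base y) = 1 ∧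
      IdealSheafData.IsPermissible (vanishingIdeal (⟨{(pullback.snd π (W.fromSpecStalk x)).base y},
        Moving.isClosed_singleton_of_fromSpecStalk_eq hyc⟩ : Closeds ↥(Spec (W.presheaf.stalk x)))) ∧
      IsBlowup (pullback.snd π (W.fromSpecStalk x)) (vanishingIdeal (⟨{(pullback.snd π (W.fromSpecStalk x)).base y},
        Moving.isClosed_singleton_of_fromSpecStalk_eq hyc⟩ : Closeds ↥(Spec (W.presheaf.stalk x)))) := by
  have hcp := Moving.eq_closedPoint_of_fromSpecStalk_eq hyc
  refine ⟨Scheme.isExcellent_Spec_of_isExcellentRing _ (isExcellentRing_stalk_of_isExcellent hexc x),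
    ((W.fromSpecStalk x).isEmbedding.isInducing.topologicalKrullDim_le).trans hdim, ?_, ?_,
    isPermissible_vanishingIdeal_singleton_of_fromSpecStalk_eq_of_one_le_dirDim (by omega) hyc,
    Moving.isBlowup_pullback_snd_fromSpecStalk_singleton hπ hC hx hyc⟩
  · rw [hcp]; exact charHypothesis_spec_stalk hchar
  · rw [hcp, Scheme.dirDim_fromSpecStalk_closedPoint]; exact he

/-- **THE RATIONAL LIFT.** In the situation of the module docstring (point-like genuine step at `x` with `e_x(W) = 1`, (F1), near
point `x'`), `x'` lifts to the local blow-up `W' ×_W Spec 𝒪_{W,x} → Spec 𝒪_{W,x}` of the closed point as a point `y` with the SAME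
local ring, lying on `ℙ(Dir)` of the closed point and `κ`-RATIONAL over it (modulo CJS Thm. 3.14 point-locus form and `ProjDir_line`).
[cite: CossartJannsenSaito2020, Thm. 3.14, Def. 6.34 (i), p. 103 L32, p. 107] -/
theorem exists_rational_lift_of_near_of_dirDim_eq_one [IsLocallyNoetherian W] [IsLocallyNoetherian W']
    (h314 : Thm314_point_locus.{u}) (hline : ProjDir_line.{u}) (hexc : Scheme.IsExcellent W) {N : ℕ} (hdim : topologicalKrullDim W ≤ (N : WithBot ℕ∞)) {π : W' ⟶ W}
    {C : W.IdealSheafData} (hπ : IsBlowup π C) (hC : C = vanishingIdeal C.support) {x : W}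
    (hx : stalkIdeal C x = maximalIdeal (W.presheaf.stalk x)) (hchar : CharHypothesis W x) (he : Scheme.dirDim W x = 1)
    {x' : W'} (hx' : π.base x' = x) (hnear : Scheme.hsFun W' N x' = Scheme.hsFun W N x) :
    ∃ y : ↥(pullback π (W.fromSpecStalk x)),
      (pullback.fst π (W.fromSpecStalk x)).base y = x' ∧
        (W.fromSpecStalk x).base ((pullback.snd π (W.fromSpecStalk x)).base y) = x ∧
        IsIso ((pullback.fst π (W.fromSpecStalk x)).stalkMap y) ∧
        Scheme.hsFun (pullback π (W.fromSpecStalk x)) N y =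
          Scheme.hsFun (Spec (W.presheaf.stalk x)) N ((pullback.snd π (W.fromSpecStalk x)).base y) ∧
        IsOnProjDirectrix (pullback.snd π (W.fromSpecStalk x)) y ∧
        IsIso ((pullback.snd π (W.fromSpecStalk x)).residueFieldMap y) := by
  haveI : IsLocallyNoetherian (pullback π (W.fromSpecStalk x)) := Moving.isLocallyNoetherian_pullback_fromSpecStalk hπ x
  obtain ⟨y, hy, hyc, hiso⟩ := Moving.exists_lift_pullback_fromSpecStalk π x hx'
  obtain ⟨hexc', hdim', hchar', he', hperm, hloc⟩ := localSetting_of_lift hexc hdim hπ hC hx hchar he hyc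
  have hnear' : Scheme.hsFun (pullback π (W.fromSpecStalk x)) N y =
      Scheme.hsFun (Spec (W.presheaf.stalk x)) N ((pullback.snd π (W.fromSpecStalk x)).base y) := by
    rw [Moving.hsFun_lift_eq, hy, hnear, Scheme.hsFun_fromSpecStalk, hyc]
  have hon : IsOnProjDirectrix (pullback.snd π (W.fromSpecStalk x)) y :=
    h314 _ _ (pullback.snd π (W.fromSpecStalk x)) _ (Moving.isClosed_singleton_of_fromSpecStalk_eq hyc) N y
      hexc' hperm hloc hdim' rfl hchar' hnear'
  have hrat := (hline _ _ (pullback.snd π (W.fromSpecStalk x)) _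
    (Moving.isClosed_singleton_of_fromSpecStalk_eq hyc) hloc he').2 y ⟨rfl, hon⟩
  exact ⟨y, hy, hyc, hiso, hnear', hon, hrat⟩

/-- **THE RATIONAL NEAR STEP KEEPS `e ≤ 1`.** In the situation of the module docstring: `e_{x'}(W') ≤ 1` (modulo CJS Thm. 3.14
point-locus form, `ProjDir_line`, and Thm. 3.10 (4)). This is the inductive step making the fundamental sequence over an isolated
`e = 1` point a sequence of blow-ups in `κ`-rational closed points (CJS Cor. 6.37 / Def. 6.34 (i); p. 103 L32 «if `e_x(X) ≤ 1` …
`k(y) = k(x)`»). [cite: CossartJannsenSaito2020, Thm. 3.14, Thm. 3.10 (4), Cor. 6.37, p. 103] -/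
theorem dirDim_le_one_of_near_of_dirDim_eq_one [IsLocallyNoetherian W] [IsLocallyNoetherian W']
    (h314 : Thm314_point_locus.{u}) (hline : ProjDir_line.{u}) (h310 : CossartJannsenSaito2020_thm_3_10_4.{u})
    (hexc : Scheme.IsExcellent W) {N : ℕ}
    (hdim : topologicalKrullDim W ≤ (N : WithBot ℕ∞)) {π : W' ⟶ W} {C : W.IdealSheafData} (hπ : IsBlowup π C)
    (hC : C = vanishingIdeal C.support) {x : W} (hx : stalkIdeal C x = maximalIdeal (W.presheaf.stalk x))
    (hchar : CharHypothesis W x) (he : Scheme.dirDim W x = 1) {x' : W'} (hx' : π.base x' = x)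
    (hnear : Scheme.hsFun W' N x' = Scheme.hsFun W N x) : Scheme.dirDim W' x' ≤ 1 := by
  haveI : IsLocallyNoetherian (pullback π (W.fromSpecStalk x)) := Moving.isLocallyNoetherian_pullback_fromSpecStalk hπ x
  obtain ⟨y, hy, hyc, -, hnear', -, hrat⟩ :=
    exists_rational_lift_of_near_of_dirDim_eq_one h314 hline hexc hdim hπ hC hx hchar he hx' hnear
  obtain ⟨hexc', hdim', -, he', hperm, hloc⟩ := localSetting_of_lift hexc hdim hπ hC hx hchar he hyc
  have hsupp : (pullback.snd π (W.fromSpecStalk x)).base y ∈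
      ((vanishingIdeal (⟨{(pullback.snd π (W.fromSpecStalk x)).base y}, Moving.isClosed_singleton_of_fromSpecStalk_eq hyc⟩ :
        Closeds ↥(Spec (W.presheaf.stalk x)))).support : Set ↥(Spec (W.presheaf.stalk x))) := by
    rw [Scheme.IdealSheafData.coe_support_vanishingIdeal]
    exact Set.mem_singleton _
  have hle := dirDim_le_of_hsFun_eq_of_isIso_residueFieldMap h310 hexc' hperm hloc hdim' hsupp hnear'
  rw [he', Moving.dirDim_lift_eq π x y, hy] at hle
  exact hle

/-- **`e = 1` EXACTLY at the near point when it is blown up again**: if moreover `e_{x'}(W') ≥ 1` (e.g. `x'` lies in a later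
permissible centre of positive codimension, or is near and non-regular), then `e_{x'}(W') = 1`. [cite: CossartJannsenSaito2020, Cor. 6.37] -/
theorem dirDim_eq_one_of_near_of_dirDim_eq_one [IsLocallyNoetherian W] [IsLocallyNoetherian W']
    (h314 : Thm314_point_locus.{u}) (hline : ProjDir_line.{u}) (h310 : CossartJannsenSaito2020_thm_3_10_4.{u})
    (hexc : Scheme.IsExcellent W) {N : ℕ}
    (hdim : topologicalKrullDim W ≤ (N : WithBot ℕ∞)) {π : W' ⟶ W} {C : W.IdealSheafData} (hπ : IsBlowup π C)
    (hC : C = vanishingIdeal C.support) {x : W} (hx : stalkIdeal C x = maximalIdeal (W.presheaf.stalk x))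
    (hchar : CharHypothesis W x) (he : Scheme.dirDim W x = 1) {x' : W'} (hx' : π.base x' = x)
    (hnear : Scheme.hsFun W' N x' = Scheme.hsFun W N x) (he' : 1 ≤ Scheme.dirDim W' x') : Scheme.dirDim W' x' = 1 :=
  le_antisymm (dirDim_le_one_of_near_of_dirDim_eq_one h314 hline h310 hexc hdim hπ hC hx hchar he hx' hnear) he'

end Step

end Summit.ResolutionOfSingularities.ResolutionOfSingularities.Theorems.SigmaMaxModificationsCorridor3.Helpers

end
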